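import Summits.CriticalPhenomena.PercolationContinuityZ3.Theorems.Transplant.Slab111VBundle
import HarnessLib

/-!
# The routing certificate for `ShapedLinkage 3 (Slab111.hexShadow k)`, VII: reading the certificate test `certOK`

builds on p205010 (kernel theorem, internal audit signed; external expert review pending) — NOT used in this file.  Lane `prim-bschramm`, seat
`prim-bschramm-p2` (gen 35; class C1b; memo `HOME/bschramm/P2-LATTICES.md` §129); helper file (`--supports stmt-CriticalPhenomena-4575 --as helper`).
`Srch.certOK SS c₁ c₂ c₃ = true` («Slab111VSearch», established per block type by `decide`) says: for every residue context `S ∈ SS` and every item of the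
need list, the searched bundle contains a usable plan (checked, fitting the columns, `kmin ≤ KMAX`) serving the item — for a stack item one of each
orientation.  This file extracts that statement (`plan_of_certOK`, `stackPlans_of_certOK`), reading the status masks of `planInfo` back into `PlanD.allows`.
[cite: DuminilCopinSidoraviciusTassion2016, §2.3 (proof of Fact 2)]
-/

namespace Summit.CriticalPhenomena.PercolationContinuityZ3.Theorems.Transplant

namespace Slab111

namespace Srch

/-- Bits of a conditional fold of distinct flags: a set bit comes from a true test. [folklore] -/
theorem of_testBit_foldl {p : ℕ → Bool} : ∀ (L : List ℕ) (acc : ℕ) (s : ℕ),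
    (L.foldl (fun acc s => if p s then acc ||| bit s else acc) acc).testBit s = true → acc.testBit s = true ∨ p s = true
  | [], acc, s, h => Or.inl h
  | x :: L, acc, s, h => by
    simp only [List.foldl_cons] at h
    rcases of_testBit_foldl L _ s h with h' | h'
    · by_cases hp : p x = true
      · rw [if_pos hp] at h'
        rw [bit, Nat.one_shiftLeft, Nat.testBit_or] at h'
        rcases Bool.or_eq_true_iff.1 h' with h'' | h''
        · exact Or.inl h''
        · by_cases hxs : x = s
          · subst hxs; exact Or.inr hp
          · rw [Nat.testBit_two_pow_of_ne hxs] at h''; exact absurd h'' Bool.false_ne_true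
      · rw [if_neg hp] at h'; exact Or.inl h'
    · exact Or.inr h'

/-- **The status mask of `planInfo` is sound**: a set bit is a served status. [folklore] -/
theorem allows_of_mask {T : CtxT} {kind : Kind} {t : TermD} {s : ℕ}
    (h : (STATUSES.foldl (fun acc s => if t.allowsT T kind s then acc ||| bit s else acc) 0).testBit s = true) :
    t.allowsT T kind s = true := by
  rcases of_testBit_foldl (p := fun s => t.allowsT T kind s) STATUSES 0 s h with h' | h'
  · simp at h'
  · exact h'

/-- `stkIs` reads the kind. [folklore] -/
theorem stkIs_eq_some {P : PlanD} {l : Bool} (h : stkIs P = some l) : ∃ lam0, P.kind = Kind.stk lam0 l := by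
  unfold stkIs at h; cases hk : P.kind <;> simp [hk] at h; exact ⟨_, by rw [h]⟩

/-- `stkIs = none`: not a stack plan. [folklore] -/
theorem stkIs_eq_none {P : PlanD} (h : stkIs P = none) : ∀ lam0 l, P.kind ≠ Kind.stk lam0 l := by
  unfold stkIs at h; intro lam0 l hk; simp [hk] at h

/-- What a usable plan summary gives. [folklore] -/
theorem usable_of_planInfo {T : CtxT} {c1 c2 c3 : Col} {P : PlanD} {it : ℕ × ℕ × ℕ}
    (h1 : (planInfo T c1 c2 c3 P).1 = true) (hm1 : hasBit (planInfo T c1 c2 c3 P).2.2.1 it.1 = true)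
    (hm2 : hasBit (planInfo T c1 c2 c3 P).2.2.2.1 it.2.1 = true) (hm3 : hasBit (planInfo T c1 c2 c3 P).2.2.2.2 it.2.2 = true) :
    P.checkT T = true ∧ P.fits c1 c2 c3 = true ∧ P.kmin ≤ KMAX ∧ P.allowsT T it.1 it.2.1 it.2.2 = true := by
  simp only [planInfo, Bool.and_eq_true, decide_eq_true_eq] at h1
  simp only [planInfo, hasBit] at hm1 hm2 hm3
  rw [Nat.testBit_and] at hm3
  simp only [Bool.and_eq_true] at hm3
  refine ⟨h1.1.1, h1.1.2, h1.2, ?_⟩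
  simp only [PlanD.allowsT, Bool.and_eq_true]
  exact ⟨⟨⟨allows_of_mask hm1, allows_of_mask hm2⟩, allows_of_mask hm3.1⟩, allows_of_mask hm3.2⟩

/-- Reading `certOK`: every need item of every listed residue is covered. [folklore] -/
theorem covered_of_certOK {SS : List SCtx} {c1 c2 c3 : Col} (h : certOK SS c1 c2 c3 = true) {S : SCtx} (hS : S ∈ SS) {it : ℕ × ℕ × ℕ}
    (hit : it ∈ needItems S.T c1 c2 c3) : coveredI c1 c2 ((searchBundle SS c1 c2 c3).map (planInfo S.T c1 c2 c3)) it = true := by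
  simp only [certOK, List.all_eq_true] at h
  have h' := h S hS
  generalize hl : needItems S.T c1 c2 c3 = l at h' hit
  match l, h', hit with
  | [], _, hit => simp at hit
  | _ :: _, h', hit => simp only [List.all_eq_true] at h'; exact h' it hit

/-- **A non-stack item of the need list is served by a usable non-stack plan of the bundle.** [folklore] -/
theorem plan_of_certOK {SS : List SCtx} {c1 c2 c3 : Col} (h : certOK SS c1 c2 c3 = true) {S : SCtx} (hS : S ∈ SS) {it : ℕ × ℕ × ℕ}
    (hit : it ∈ needItems S.T c1 c2 c3) (hns : isStackItem c1 c2 it = false) :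
    ∃ P : PlanD, P.checkT S.T = true ∧ P.fits c1 c2 c3 = true ∧ P.kmin ≤ KMAX ∧ (∀ lam0 l, P.kind ≠ Kind.stk lam0 l) ∧
      P.allowsT S.T it.1 it.2.1 it.2.2 = true := by
  have := covered_of_certOK h hS hit
  simp only [coveredI, hns] at this
  simp only [Bool.false_eq_true, ↓reduceIte, List.any_eq_true, List.mem_map, Bool.and_eq_true, beq_iff_eq] at this
  obtain ⟨x, ⟨P, hP, rfl⟩, hnone, ⟨⟨h1, hm1⟩, hm2⟩, hm3⟩ := this
  obtain ⟨hc, hf, hk, ha⟩ := usable_of_planInfo h1 hm1 hm2 hm3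
  exact ⟨P, hc, hf, hk, stkIs_eq_none hnone, ha⟩

/-- **A stack item is served by usable stack plans of both orientations.** [folklore] -/
theorem stackPlans_of_certOK {SS : List SCtx} {c1 c2 c3 : Col} (h : certOK SS c1 c2 c3 = true) {S : SCtx} (hS : S ∈ SS) {it : ℕ × ℕ × ℕ}
    (hit : it ∈ needItems S.T c1 c2 c3) (hst : isStackItem c1 c2 it = true) (l : Bool) :
    ∃ P : PlanD, P.checkT S.T = true ∧ P.fits c1 c2 c3 = true ∧ P.kmin ≤ KMAX ∧ (∃ lam0, P.kind = Kind.stk lam0 l) ∧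
      P.allowsT S.T it.1 it.2.1 it.2.2 = true := by
  have := covered_of_certOK h hS hit
  simp only [coveredI, hst, ↓reduceIte, Bool.and_eq_true, List.any_eq_true, List.mem_map, beq_iff_eq] at this
  obtain ⟨⟨x, ⟨P, hP, rfl⟩, hsome, ⟨⟨h1, hm1⟩, hm2⟩, hm3⟩, ⟨x', ⟨P', hP', rfl⟩, hsome', ⟨⟨h1', hm1'⟩, hm2'⟩, hm3'⟩⟩ := this
  cases l
  · obtain ⟨hc, hf, hk, ha⟩ := usable_of_planInfo h1' hm1' hm2' hm3'
    exact ⟨P', hc, hf, hk, stkIs_eq_some hsome', ha⟩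
  · obtain ⟨hc, hf, hk, ha⟩ := usable_of_planInfo h1 hm1 hm2 hm3
    exact ⟨P, hc, hf, hk, stkIs_eq_some hsome, ha⟩

/-- **Reading the type certificate**: every non-excluded configuration of candidate columns passes `certOK`. [folklore] -/
theorem certOK_of_certAllB {K : BKey} (h : certAllB K = true) {c1 c2 c3 : Col} (h1 : c1 ∈ eCols (sctxs K)) (h2 : c2 ∈ eCols (sctxs K))
    (h3 : c3 ∈ wCols (sctxs K)) (hx : excluded c1 c2 c3 = false) : certOK (sctxs K) c1 c2 c3 = true := by
  obtain ⟨i, hi, hc⟩ := List.getElem_of_mem h1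
  simp only [certAllB, List.all_eq_true, List.mem_range] at h
  have hr := h i hi
  simp only [certRow, List.getElem?_eq_getElem hi, hc, List.all_eq_true, Bool.or_eq_true] at hr
  rcases hr c2 h2 c3 h3 with hr | hr
  · rw [hx] at hr; exact absurd hr Bool.false_ne_true
  · exact hr

/-- `isStackItem` read back. [folklore] -/
theorem isStackItem_iff {c1 c2 : Col} {it : ℕ × ℕ × ℕ} : isStackItem c1 c2 it = true ↔ c1 = c2 ∧ it.1 = 9 ∧ it.2.1 = 9 := by
  simp [isStackItem, and_assoc]

end Srch

end Slab111

end Summit.CriticalPhenomena.PercolationContinuityZ3.Theorems.Transplant
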